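import Summits.AtomisticToContinuum.FouriersLaw.Theorems.BoundaryEscapeDeficitBoundaryKernelBasics
import Mathlib.Analysis.SpecialFunctions.ImproperIntegrals

/-!
# `SubdiffusiveBondHeat` / line `bath-bond-deficit-integral`: the relaxation transient of the bath-heat law at fixed `N`

Support for the lead's stub `stub_transientEW` of crux `stmt-AtomisticToContinuum-9120`
(`BondHeatUncertainty.SubdiffusiveBondHeat`): the stub asks for the `N`-UNIFORM Edwards–Wilkinson bound
`∫₀ᵗ (1 - θ_N(s) - E_N) ds ≤ C₂ √t` on `[1, cN²]`, with `θ_N(s) = (γ/T²)∫₀ˢ K_N`, `E_N = 1 - (γ/T²)∫_{(0,∞)} K_N`,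
`K_N(u) = ⟨p₀² - T, P_u(p₀² - T)⟩_{μ_T}`. Now that `BoundaryKernelBasics` is proved
(`BoundaryEscapeDeficitBoundaryKernelBasics.lean`: `K_N` continuous, `|K_N| ≤ C e^{-cu}`, `K_N ∈ L¹(0,∞)`), the objects are
honest and the transient has a closed form at every FIXED `N`:

* `pinnedChain_deficit_transient_eq` — `1 - θ_N(s) - E_N = (γ/T²) ∫_{(s,∞)} K_N` for `s ≥ 0` (registered sub-goal
  `pinnedChain_transient_eq_tail` of the crux);
* `pinnedChain_abs_transient_le` — hence `|1 - θ_N(s) - E_N| ≤ C' e^{-cs}` (`s ≥ 0`);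
* `pinnedChain_transientIntegral_le_fixedN` — and `∫₀ᵗ (1 - θ_N - E_N) ≤ C'/c` for all `t ≥ 0`: at fixed `N` the
  once-integrated transient is BOUNDED. So the whole content of `stub_transientEW` is the uniformity in `N` of this
  bound with the allowed growth `√t` up to the Thouless time (the constants `C', c` here come from the spectral data of
  the `N`-chain and degrade with `N`). Nothing here closes an item.
-/

noncomputable section

open MeasureTheory ProbabilityTheory Filter Topology Set
open scoped NNReal ENNReal

namespace Summit.AtomisticToContinuum.FouriersLaw.Theorems.SubdiffusiveBondHeat

open Literature.MathematicalPhysics.KineticTheory.HeatConduction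
open Literature.MathematicalPhysics.KineticTheory OscillatorChain

section Transient

variable {ω₂ lam β γ : ℝ} (hω : 0 < ω₂) (hl : 0 < lam) (hβ : 0 < β) (hγ : 0 < γ) {N : ℕ} (hN : 0 < N)
  {T : ℝ} (hT : 0 < T)
include hω hl hβ hγ hN hT

/-- **The transient is the tail of the boundary kernel** (registered sub-goal `pinnedChain_transient_eq_tail`):
for `s ≥ 0`, `1 - θ_N(s) - E_N = (γ/T²) ∫_{(s,∞)} K_N`, with `θ_N`, `E_N`, `K_N` spelled VERBATIM as in
`stub_transientEW` (the `dite` on `0 < N` included). Uses `K_N ∈ L¹(0,∞)` (`boundaryKernelBasics_proof`). [folklore] -/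
theorem pinnedChain_deficit_transient_eq (s : ℝ) (hs : 0 ≤ s) :
    (1 - γ / T ^ 2 * (∫ u in (0 : ℝ)..s,
        if h : 0 < N then
          ∫ z, ((z.2 ⟨0, h⟩) ^ 2 - T) *
              (∫ y, ((y.2 ⟨0, h⟩) ^ 2 - T) ∂((pinnedChain ω₂ lam β γ).transitionKernel N T T u.toNNReal z))
            ∂((pinnedChain ω₂ lam β γ).gibbsMeasure N T)
        else 0) -
      (1 - γ / T ^ 2 * (∫ u in Set.Ioi (0 : ℝ),
        if h : 0 < N then
          ∫ z, ((z.2 ⟨0, h⟩) ^ 2 - T) *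
              (∫ y, ((y.2 ⟨0, h⟩) ^ 2 - T) ∂((pinnedChain ω₂ lam β γ).transitionKernel N T T u.toNNReal z))
            ∂((pinnedChain ω₂ lam β γ).gibbsMeasure N T)
        else 0))) =
      γ / T ^ 2 * ∫ u in Set.Ioi s,
        ∫ z, ((z.2 ⟨0, hN⟩) ^ 2 - T) *
            (∫ y, ((y.2 ⟨0, hN⟩) ^ 2 - T) ∂((pinnedChain ω₂ lam β γ).transitionKernel N T T u.toNNReal z))
          ∂((pinnedChain ω₂ lam β γ).gibbsMeasure N T) := by
  simp only [dif_pos hN]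
  obtain ⟨-, -, -, -, hL1⟩ := boundaryKernelBasics_proof ω₂ lam β γ hω hl hβ hγ T hT N hN
  simp only [dif_pos hN] at hL1
  rw [← intervalIntegral.integral_Ioi_sub_Ioi hL1 hs]
  ring

/-- **Exponential decay of the transient at fixed `N`**: `|1 - θ_N(s) - E_N| ≤ C' e^{-cs}` for `s ≥ 0`, i.e.
`|(γ/T²)∫_{(s,∞)} K_N| ≤ (γ/T²)(C/c) e^{-cs}` from `|K_N(u)| ≤ C e^{-cu}`. [folklore] -/
theorem pinnedChain_abs_transient_le :
    ∃ C c : ℝ, 0 ≤ C ∧ 0 < c ∧ ∀ s : ℝ, 0 ≤ s →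
      |γ / T ^ 2 * ∫ u in Set.Ioi s,
          ∫ z, ((z.2 ⟨0, hN⟩) ^ 2 - T) *
              (∫ y, ((y.2 ⟨0, hN⟩) ^ 2 - T) ∂((pinnedChain ω₂ lam β γ).transitionKernel N T T u.toNNReal z))
            ∂((pinnedChain ω₂ lam β γ).gibbsMeasure N T)| ≤ C * Real.exp (-c * s) := by
  obtain ⟨-, -, -, ⟨C, c, hc, hdec⟩, hL1⟩ := boundaryKernelBasics_proof ω₂ lam β γ hω hl hβ hγ T hT N hN
  simp only [dif_pos hN] at hdec hL1
  set K : ℝ → ℝ := fun u => ∫ z, ((z.2 ⟨0, hN⟩) ^ 2 - T) *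
      (∫ y, ((y.2 ⟨0, hN⟩) ^ 2 - T) ∂((pinnedChain ω₂ lam β γ).transitionKernel N T T u.toNNReal z))
    ∂((pinnedChain ω₂ lam β γ).gibbsMeasure N T) with hK
  have hC0 : 0 ≤ C := by
    have := (abs_nonneg _).trans (hdec 0 le_rfl)
    simpa using this
  refine ⟨γ / T ^ 2 * (C / c), c, by positivity, hc, fun s hs => ?_⟩
  -- `|∫_{(s,∞)} K| ≤ ∫_{(s,∞)} C e^{-cu} = (C/c) e^{-cs}`
  have hbound : ∀ᵐ u ∂(volume.restrict (Ioi s)), ‖K u‖ ≤ C * Real.exp (-c * u) :=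
    (ae_restrict_iff' measurableSet_Ioi).2 (Eventually.of_forall fun u hu => by
      rw [Real.norm_eq_abs]; exact hdec u (hs.trans (le_of_lt hu)))
  have hexp : IntegrableOn (fun u => C * Real.exp (-c * u)) (Ioi s) :=
    (exp_neg_integrableOn_Ioi s hc).const_mul C
  have h1 := norm_integral_le_of_norm_le hexp hbound
  have hval : ∫ u in Ioi s, C * Real.exp (-c * u) = C / c * Real.exp (-c * s) := by
    rw [integral_const_mul, integral_exp_mul_Ioi (by linarith) s]
    field_simp
  rw [hval, Real.norm_eq_abs] at h1
  rw [abs_mul, abs_of_nonneg (by positivity : (0:ℝ) ≤ γ / T ^ 2)]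
  calc γ / T ^ 2 * |∫ u in Ioi s, K u| ≤ γ / T ^ 2 * (C / c * Real.exp (-c * s)) :=
        mul_le_mul_of_nonneg_left h1 (by positivity)
    _ = γ / T ^ 2 * (C / c) * Real.exp (-c * s) := by ring

/-- **At fixed `N` the once-integrated transient is bounded**: with `C', c` of `pinnedChain_abs_transient_le`,
`∫₀ᵗ (1 - θ_N(s) - E_N) ds ≤ C'/c` for every `t ≥ 0` — so `stub_transientEW` is exactly the `N`-UNIFORMITY (with
growth `√t` on `[1, cN²]`) of a quantity that is finite chain by chain. [folklore] -/
theorem pinnedChain_transientIntegral_le_fixedN :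
    ∃ B : ℝ, ∀ t : ℝ, 0 ≤ t →
      (∫ s in (0 : ℝ)..t,
        (1 - γ / T ^ 2 * (∫ u in (0 : ℝ)..s,
            if h : 0 < N then
              ∫ z, ((z.2 ⟨0, h⟩) ^ 2 - T) *
                  (∫ y, ((y.2 ⟨0, h⟩) ^ 2 - T) ∂((pinnedChain ω₂ lam β γ).transitionKernel N T T u.toNNReal z))
                ∂((pinnedChain ω₂ lam β γ).gibbsMeasure N T)
            else 0) -
          (1 - γ / T ^ 2 * (∫ u in Set.Ioi (0 : ℝ),
            if h : 0 < N then
              ∫ z, ((z.2 ⟨0, h⟩) ^ 2 - T) *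
                  (∫ y, ((y.2 ⟨0, h⟩) ^ 2 - T) ∂((pinnedChain ω₂ lam β γ).transitionKernel N T T u.toNNReal z))
                ∂((pinnedChain ω₂ lam β γ).gibbsMeasure N T)
            else 0)))) ≤ B := by
  obtain ⟨C, c, hC0, hc, hdec⟩ := pinnedChain_abs_transient_le hω hl hβ hγ hN hT
  refine ⟨C / c, fun t ht => ?_⟩
  -- rewrite the integrand on `[0, t]` through the tail formula
  have hcongr : ∫ s in (0 : ℝ)..t,
      (1 - γ / T ^ 2 * (∫ u in (0 : ℝ)..s,
          if h : 0 < N then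
            ∫ z, ((z.2 ⟨0, h⟩) ^ 2 - T) *
                (∫ y, ((y.2 ⟨0, h⟩) ^ 2 - T) ∂((pinnedChain ω₂ lam β γ).transitionKernel N T T u.toNNReal z))
              ∂((pinnedChain ω₂ lam β γ).gibbsMeasure N T)
          else 0) -
        (1 - γ / T ^ 2 * (∫ u in Set.Ioi (0 : ℝ),
          if h : 0 < N then
            ∫ z, ((z.2 ⟨0, h⟩) ^ 2 - T) *
                (∫ y, ((y.2 ⟨0, h⟩) ^ 2 - T) ∂((pinnedChain ω₂ lam β γ).transitionKernel N T T u.toNNReal z))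
              ∂((pinnedChain ω₂ lam β γ).gibbsMeasure N T)
          else 0))) =
      ∫ s in (0 : ℝ)..t, γ / T ^ 2 * ∫ u in Set.Ioi s,
        ∫ z, ((z.2 ⟨0, hN⟩) ^ 2 - T) *
            (∫ y, ((y.2 ⟨0, hN⟩) ^ 2 - T) ∂((pinnedChain ω₂ lam β γ).transitionKernel N T T u.toNNReal z))
          ∂((pinnedChain ω₂ lam β γ).gibbsMeasure N T) := by
    refine intervalIntegral.integral_congr fun s hs => ?_
    rw [uIcc_of_le ht] at hs
    exact pinnedChain_deficit_transient_eq hω hl hβ hγ hN hT s hs.1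
  rw [hcongr, intervalIntegral.integral_of_le ht]
  set f : ℝ → ℝ := fun s => γ / T ^ 2 * ∫ u in Set.Ioi s,
      ∫ z, ((z.2 ⟨0, hN⟩) ^ 2 - T) *
          (∫ y, ((y.2 ⟨0, hN⟩) ^ 2 - T) ∂((pinnedChain ω₂ lam β γ).transitionKernel N T T u.toNNReal z))
        ∂((pinnedChain ω₂ lam β γ).gibbsMeasure N T) with hf
  have hb : ∀ᵐ s ∂(volume.restrict (Ioc 0 t)), ‖f s‖ ≤ C * Real.exp (-c * s) :=
    (ae_restrict_iff' measurableSet_Ioc).2 (Eventually.of_forall fun s hs => by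
      rw [Real.norm_eq_abs]; exact hdec s hs.1.le)
  have hIoi : IntegrableOn (fun s => C * Real.exp (-c * s)) (Ioi 0) := (exp_neg_integrableOn_Ioi 0 hc).const_mul C
  have h1 := norm_integral_le_of_norm_le (hIoi.mono_set Ioc_subset_Ioi_self) hb
  have h2 : ∫ s in Ioc 0 t, C * Real.exp (-c * s) ≤ ∫ s in Ioi 0, C * Real.exp (-c * s) :=
    setIntegral_mono_set hIoi (Eventually.of_forall fun s => by positivity) (Eventually.of_forall Ioc_subset_Ioi_self)
  have h3 : ∫ s in Ioi 0, C * Real.exp (-c * s) = C / c := by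
    rw [integral_const_mul, integral_exp_mul_Ioi (by linarith) 0]
    simp only [mul_zero, Real.exp_zero]
    field_simp
  calc ∫ s in Ioc 0 t, f s ≤ ‖∫ s in Ioc 0 t, f s‖ := Real.le_norm_self _
    _ ≤ ∫ s in Ioc 0 t, C * Real.exp (-c * s) := h1
    _ ≤ C / c := h2.trans h3.le

end Transient

/-- **Registered sub-goal `pinnedChain_transient_eq_tail` of crux stmt-AtomisticToContinuum-9120** (line
`bath-bond-deficit-integral`, under `stub_transientEW`): the transient of the bath-heat law is the tail of the boundary
kernel, `1 - θ_N(s) - E_N = (γ/T²)∫_{(s,∞)} K_N` (`s ≥ 0`), all objects verbatim as in the stub. [folklore] -/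
theorem pinnedChain_transient_eq_tail :
    ∀ ω₂ lam β γ : ℝ, 0 < ω₂ → 0 < lam → 0 < β → 0 < γ → ∀ T : ℝ, 0 < T → ∀ (N : ℕ) (hN : 0 < N) (s : ℝ), 0 ≤ s → (1 - γ / T ^ 2 * (∫ u in (0 : ℝ)..s, if h : 0 < N then ∫ z, ((z.2 ⟨0, h⟩) ^ 2 - T) * (∫ y, ((y.2 ⟨0, h⟩) ^ 2 - T) ∂((pinnedChain ω₂ lam β γ).transitionKernel N T T u.toNNReal z)) ∂((pinnedChain ω₂ lam β γ).gibbsMeasure N T) else 0) - (1 - γ / T ^ 2 * (∫ u in Set.Ioi (0 : ℝ), if h : 0 < N then ∫ z, ((z.2 ⟨0, h⟩) ^ 2 - T) * (∫ y, ((y.2 ⟨0, h⟩) ^ 2 - T) ∂((pinnedChain ω₂ lam β γ).transitionKernel N T T u.toNNReal z)) ∂((pinnedChain ω₂ lam β γ).gibbsMeasure N T) else 0))) = γ / T ^ 2 * ∫ u in Set.Ioi s, ∫ z, ((z.2 ⟨0, hN⟩) ^ 2 - T) * (∫ y, ((y.2 ⟨0, hN⟩) ^ 2 - T) ∂((pinnedChain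 ω₂ lam β γ).transitionKernel N T T u.toNNReal z)) ∂((pinnedChain ω₂ lam β γ).gibbsMeasure N T) :=
  fun _ _ _ _ hω hl hβ hγ _ hT _ hN s hs => pinnedChain_deficit_transient_eq hω hl hβ hγ hN hT s hs

end Summit.AtomisticToContinuum.FouriersLaw.Theorems.SubdiffusiveBondHeat

end
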